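import Mathlib
import Summits.Ventures.PercRepro2.Defs
import Summits.Ventures.PercRepro2.Independence
import Summits.Ventures.PercRepro2.Harris
import Summits.Ventures.PercRepro2.Graph
import Summits.Ventures.PercRepro2.Exploration
import Summits.Ventures.PercRepro2.Events
import Summits.Ventures.PercRepro2.Induced
import Summits.Ventures.PercRepro2.BHK
import Summits.Ventures.PercRepro2.BHKEvents
import Summits.Ventures.PercRepro2.OneEdge
import Summits.Ventures.PercRepro2.RBRoot
import Summits.Ventures.PercRepro2.RBRootEdge
import Summits.Ventures.PercRepro2.RBRootEdgePin
import Summits.Ventures.PercRepro2.RBRootEdgeMain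
import Summits.Ventures.PercRepro2.RBRootEdgeT
import Summits.Ventures.PercRepro2.RBRootIsolated
import Summits.Ventures.PercRepro2.RBTwoMarkers
import Summits.Ventures.PercRepro2.RBTwoMarkersMain
import Summits.Ventures.PercRepro2.RBTwoMarkersCross
import Summits.Ventures.PercRepro2.RBTwoMarkersCrossMain
import Summits.Ventures.PercRepro2.RBParallel
import Summits.Ventures.PercRepro2.RBDefs
import Summits.Ventures.PercRepro2.RBClubDefs
import Summits.Ventures.PercRepro2.RBClubPoly
import Summits.Ventures.PercRepro2.RBClubTwoMarkers
import Summits.Ventures.PercRepro2.RBClubTwoMarkersMain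
import Summits.Ventures.PercRepro2.RBClubRoot

/-!
# THEOREM 2′RB-CLUB-K — the coarse row at every kernel third vertex (blind cell PercRepro2,
mine-a g8; MINE-A.md §49, proofs/MINEA-CLUB.md §7)

`RB.Club_of_nbhd'`: for `w ∉ {s, t, b, o}` whose edges of nonzero weight all end in `{s, t, b, o}`
(any multiplicity), `RB.Club p ends o b s t w` — the RB-free coarse strengthening
`μ(w, b, o ∈ C_s) + μ(w ∉ C_s) μ(b ∈ C_s | w ∉ C_s) μ(o ∈ C_s | w ∉ C_s) ≥ μ(b ∈ C_s) μ(o ∈ C_s)`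
of BHK 1.3 and of the kernel row 2′RB (`RB.RBcross_and_RBsame_of_nbhd'`).
Proof: the root edges at `w` are zeroed (`RBClubRoot.Club_of_no_root_edges`, root-edge peeling
at every third vertex); what remains is a third vertex whose nonzero edges go to the markers:
two markers `RBClubTwoMarkers.club_two_markers_of_zero` (the §48 certificate), one marker
`club_one_marker_of_zero` (`P = π (Z − A) Δ`, `Δ` = BHK 1.3 of `G − w`), none `club_isolated`
(equality); parallel marker edges are merged one pair at a time (`RBParallel`).
-/

namespace Summit.Ventures.PercRepro2

namespace RBClubKernel

open scoped Classical

section Small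

variable {V : Type*} {E : Type*} [Fintype E] [DecidableEq E] [Fintype V] {R : Type*} [Field R]
  [LinearOrder R] [IsStrictOrderedRing R] (ends : E → Sym2 V) (s t w : V)

omit [Fintype V] [IsStrictOrderedRing R] in
/-- **The coarse row is symmetric in the two markers.** -/
lemma club_comm (p : E → R) (o b : V) :
    RB.Club p ends o b s t w ↔ RB.Club p ends b o s t w := by
  unfold RB.Club
  have e1 : RB.Qst ends s t ∩ connEvent ends s w ∩ connEvent ends b s ∩ connEvent ends o s =
      RB.Qst ends s t ∩ connEvent ends s w ∩ connEvent ends o s ∩ connEvent ends b s :=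
    Set.inter_right_comm _ _ _
  rw [e1, mul_comm (prob p (RB.Qst ends s t ∩ connEvent ends b s)),
    mul_comm (prob p (RB.Qst ends s t ∩ (connEvent ends s w)ᶜ ∩ connEvent ends b s))]

omit [Fintype V] [IsStrictOrderedRing R] in
/-- **The coarse row at an isolated third vertex** (every edge at `w` of weight `0`): an equality. -/
theorem club_isolated {p : E → R} (hz : ∀ e, w ∈ ends e → p e = 0) (hws : s ≠ w) (o b : V) :
    RB.Club p ends o b s t w := by
  unfold RB.Club RB.Qst
  have e0 : (connEvent ends s t)ᶜ ∩ connEvent ends s w ∩ connEvent ends b s ∩ connEvent ends o s =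
      (connEvent ends s t)ᶜ ∩ connEvent ends b s ∩ connEvent ends o s ∩ connEvent ends s w := by
    ac_rfl
  rw [e0, RBClubTwoMarkers.prob_inter_conn_eq_zero_of_closed ends s w p hz hws, zero_add,
    Set.inter_right_comm _ (connEvent ends s w)ᶜ (connEvent ends b s),
    Set.inter_right_comm _ (connEvent ends s w)ᶜ (connEvent ends o s),
    RBClubTwoMarkers.prob_inter_compl_conn_eq_of_closed ends s w p hz hws,
    RBClubTwoMarkers.prob_inter_compl_conn_eq_of_closed ends s w p hz hws,
    RBClubTwoMarkers.prob_inter_compl_conn_eq_of_closed ends s w p hz hws]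

/-- **The coarse row at a third vertex whose only edge of nonzero weight is `e₁ = {w, b}`**:
pinning `e₁`, the cleared cubic is `π (Z − A) Δ` with `Δ` = BHK 1.3 of `G − w`. -/
theorem club_one_marker_of_zero {p : E → R} (hp : IsProbVec p) {e₁ : E} {b : V} (o : V)
    (hz : ∀ e, w ∈ ends e → e ≠ e₁ → p e = 0) (hends₁ : ends e₁ = s(w, b)) (hws : s ≠ w)
    (hwt : t ≠ w) (hwb : b ≠ w) (hwo : o ≠ w) : RB.Club p ends o b s t w := by
  have hz' : ∀ e, w ∈ ends e ∧ e ≠ e₁ → p e = 0 := fun e he => hz e he.1 he.2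
  have hz0 : ∀ e, w ∈ ends e → Function.update p e₁ 0 e = 0 := by
    intro e he
    by_cases h : e = e₁
    · subst h; exact Function.update_self _ _ _
    · rw [Function.update_of_ne h]; exact hz e he h
  have hp0 : IsProbVec (Function.update p e₁ 0) := hp.update e₁ le_rfl zero_le_one
  set Q := (connEvent ends s t)ᶜ with hQ
  set M := connEvent ends s w with hM
  set bL := connEvent ends b s with hbL
  set oL := connEvent ends o s with hoL
  obtain ⟨L1a, L1b, L1c, -, L1d, -⟩ := RBTwoMarkers.prob_leaf_update_events ends w p hz' hends₁
    s t b o hws hwt hwb hwo 1 (Or.inr rfl)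
  obtain ⟨L0a, L0b, L0c, -, L0d, -⟩ := RBTwoMarkers.prob_leaf_update_events ends w p hz' hends₁
    s t b o hws hwt hwb hwo 0 (Or.inl rfl)
  set Z := prob p Q with hZ
  set A := prob p (Q ∩ bL) with hA
  set C := prob p (Q ∩ oL) with hC
  set J := prob p (Q ∩ bL ∩ oL) with hJ
  -- set identities
  have e00 : Q ∩ M ∩ bL ∩ oL = Q ∩ bL ∩ oL ∩ M := by ac_rfl
  have e00b : Q ∩ Mᶜ ∩ bL = Q ∩ bL ∩ Mᶜ := Set.inter_right_comm _ _ _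
  have e00c : Q ∩ Mᶜ ∩ oL = Q ∩ oL ∩ Mᶜ := Set.inter_right_comm _ _ _
  have e10 : Q ∩ M ∩ bL ∩ oL = Q ∩ M ∩ (bL ∩ oL) := Set.inter_assoc _ _ _
  have e10' : Q ∩ bL ∩ (bL ∩ oL) = Q ∩ bL ∩ oL := by
    ext ω
    simp only [Set.mem_inter_iff]
    exact ⟨fun ⟨⟨hQ', hb⟩, _, ho⟩ => ⟨⟨hQ', hb⟩, ho⟩, fun ⟨⟨hQ', hb⟩, ho⟩ => ⟨⟨hQ', hb⟩, hb, ho⟩⟩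
  have ebb : Q ∩ bLᶜ ∩ bL = ∅ :=
    Set.eq_empty_iff_forall_notMem.2 fun ω ⟨⟨_, h⟩, h'⟩ => h h'
  -- pattern closed: `w` isolated
  have M0 : prob (Function.update p e₁ 0) (Q ∩ M ∩ bL ∩ oL) = 0 := by
    rw [e00]; exact RBClubTwoMarkers.prob_inter_conn_eq_zero_of_closed ends s w _ hz0 hws _
  have B0 : prob (Function.update p e₁ 0) (Q ∩ Mᶜ ∩ bL) = A := by
    rw [e00b, RBClubTwoMarkers.prob_inter_compl_conn_eq_of_closed ends s w _ hz0 hws, L0b]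
  have O0 : prob (Function.update p e₁ 0) (Q ∩ Mᶜ ∩ oL) = C := by
    rw [e00c, RBClubTwoMarkers.prob_inter_compl_conn_eq_of_closed ends s w _ hz0 hws, L0c]
  have D0 : prob (Function.update p e₁ 0) (Q ∩ Mᶜ) = Z := by
    rw [RBClubTwoMarkers.prob_inter_compl_conn_eq_of_closed ends s w _ hz0 hws, L0a]
  -- pattern open: `{s ↔ w} = {b ↔ s}`
  have M1 : prob (Function.update p e₁ 1) (Q ∩ M ∩ bL ∩ oL) = J := by
    rw [e10, RBClubTwoMarkers.prob_update_one_inter_conn_eq ends s w _ hends₁, e10', L1d]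
  have B1 : prob (Function.update p e₁ 1) (Q ∩ Mᶜ ∩ bL) = 0 := by
    rw [RBClubTwoMarkers.prob_update_one_inter_compl_conn_eq ends s w _ hends₁, ebb, prob_empty]
  have O1 : prob (Function.update p e₁ 1) (Q ∩ Mᶜ ∩ oL) = C - J := by
    rw [RBClubTwoMarkers.prob_update_one_inter_compl_conn_eq ends s w _ hends₁, Set.inter_right_comm]
    have h := prob_inter_add_prob_inter_compl (Function.update p e₁ 1) (Q ∩ oL) bL
    rw [Set.inter_right_comm Q oL bL, L1d, L1c] at h
    linarith
  have D1 : prob (Function.update p e₁ 1) (Q ∩ Mᶜ) = Z - A := by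
    have h := RBClubTwoMarkers.prob_update_one_inter_compl_conn_eq ends s w p hends₁ Q Set.univ
    rw [Set.inter_univ, Set.inter_univ] at h
    rw [h]
    have h' := prob_inter_add_prob_inter_compl (Function.update p e₁ 1) Q bL
    rw [L1a, L1b] at h'
    linarith
  -- the masses of `p` as mixtures
  have h1 := prob_eq_pin p Q e₁
  have h2 := prob_eq_pin p (Q ∩ M ∩ bL ∩ oL) e₁
  have h3 := prob_eq_pin p (Q ∩ bL) e₁
  have h4 := prob_eq_pin p (Q ∩ oL) e₁
  have h5 := prob_eq_pin p (Q ∩ Mᶜ) e₁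
  have h6 := prob_eq_pin p (Q ∩ Mᶜ ∩ bL) e₁
  have h7 := prob_eq_pin p (Q ∩ Mᶜ ∩ oL) e₁
  rw [L1a, L0a] at h1
  rw [M1, M0] at h2
  rw [L1b, L0b] at h3
  rw [L1c, L0c] at h4
  rw [D1, D0] at h5
  rw [B1, B0] at h6
  rw [O1, O0] at h7
  have hΔ : 0 ≤ J * Z - A * C := by
    have := RBClubTwoMarkers.bhk_same_cleared ends s t hp b o
    linarith
  have hZA : 0 ≤ Z - A := sub_nonneg.2 (prob_mono hp Set.inter_subset_left)
  refine RBClubPoly.club_of_cleared ends hp o b s t w ?_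
  rw [h1, h2, h3, h4, h5, h6, h7]
  have key : 0 ≤ p e₁ * ((Z - A) * (J * Z - A * C)) :=
    mul_nonneg (hp.nonneg e₁) (mul_nonneg hZA hΔ)
  convert key using 1
  ring

/-- **The coarse row at a third vertex whose only edge of nonzero weight is `e₂ = {w, o}`**:
`club_one_marker_of_zero` with the markers exchanged. -/
theorem club_one_marker_o_of_zero {p : E → R} (hp : IsProbVec p) {e₂ : E} {o : V} (b : V)
    (hz : ∀ e, w ∈ ends e → e ≠ e₂ → p e = 0) (hends₂ : ends e₂ = s(w, o)) (hws : s ≠ w)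
    (hwt : t ≠ w) (hwb : b ≠ w) (hwo : o ≠ w) : RB.Club p ends o b s t w :=
  (club_comm ends s t w p o b).2 (club_one_marker_of_zero ends s t w hp b hz hends₂ hws hwt hwo hwb)

/-- **The coarse row at a third vertex whose edges of nonzero weight all go to the markers**, at
most one such edge to each marker. -/
theorem club_of_markers {p : E → R} (hp : IsProbVec p) (o b : V)
    (H : ∀ e, w ∈ ends e → p e ≠ 0 → ends e = s(w, b) ∨ ends e = s(w, o))
    (Hb : ∀ e e', ends e = s(w, b) → ends e' = s(w, b) → p e ≠ 0 → p e' ≠ 0 → e = e')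
    (Ho : ∀ e e', ends e = s(w, o) → ends e' = s(w, o) → p e ≠ 0 → p e' ≠ 0 → e = e')
    (hws : s ≠ w) (hwt : t ≠ w) (hwb : b ≠ w) (hwo : o ≠ w) : RB.Club p ends o b s t w := by
  by_cases hb : ∃ e, ends e = s(w, b) ∧ p e ≠ 0
  · obtain ⟨e₁, he₁, hp₁⟩ := hb
    by_cases ho : ∃ e, ends e = s(w, o) ∧ p e ≠ 0
    · obtain ⟨e₂, he₂, hp₂⟩ := ho
      by_cases h12 : e₁ = e₂
      · have hz : ∀ e, w ∈ ends e → e ≠ e₁ → p e = 0 := by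
          intro e he hne
          by_contra hpe
          rcases H e he hpe with h | h
          · exact hne (Hb e e₁ h he₁ hpe hp₁)
          · exact hne ((Ho e e₂ h he₂ hpe hp₂).trans h12.symm)
        exact club_one_marker_of_zero ends s t w hp o hz he₁ hws hwt hwb hwo
      · have hz : ∀ e, w ∈ ends e → e ≠ e₁ → e ≠ e₂ → p e = 0 := by
          intro e he hne₁ hne₂
          by_contra hpe
          rcases H e he hpe with h | h
          · exact hne₁ (Hb e e₁ h he₁ hpe hp₁)
          · exact hne₂ (Ho e e₂ h he₂ hpe hp₂)
        exact RBClubTwoMarkers.club_two_markers_of_zero ends s t w hp hz he₁ he₂ h12 hws hwt hwb hwo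
    · have hz : ∀ e, w ∈ ends e → e ≠ e₁ → p e = 0 := by
        intro e he hne
        by_contra hpe
        rcases H e he hpe with h | h
        · exact hne (Hb e e₁ h he₁ hpe hp₁)
        · exact ho ⟨e, h, hpe⟩
      exact club_one_marker_of_zero ends s t w hp o hz he₁ hws hwt hwb hwo
  · by_cases ho : ∃ e, ends e = s(w, o) ∧ p e ≠ 0
    · obtain ⟨e₂, he₂, hp₂⟩ := ho
      have hz : ∀ e, w ∈ ends e → e ≠ e₂ → p e = 0 := by
        intro e he hne
        by_contra hpe
        rcases H e he hpe with h | h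
        · exact hb ⟨e, h, hpe⟩
        · exact hne (Ho e e₂ h he₂ hpe hp₂)
      exact club_one_marker_o_of_zero ends s t w hp b hz he₂ hws hwt hwb hwo
    · have hz : ∀ e, w ∈ ends e → p e = 0 := by
        intro e he
        by_contra hpe
        rcases H e he hpe with h | h
        · exact hb ⟨e, h, hpe⟩
        · exact ho ⟨e, h, hpe⟩
      exact club_isolated ends s t w hz hws o b

end Small

end RBClubKernel

namespace RB

open scoped Classical

variable {V : Type*} {E : Type*} [Fintype E] [DecidableEq E] [Fintype V] [DecidableEq V]
  {R : Type*} [Field R] [LinearOrder R] [IsStrictOrderedRing R]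

/-- **THEOREM 2′RB-CLUB-K (skeleton form)**: `w ∉ {s, t, b, o}`, every edge of nonzero weight at `w`
ends in `{s, t, b, o}`, at most one such edge to `b` and at most one to `o`: the coarse row holds
at `w`. Proof: zero the root edges (`RBClubRoot.Club_of_no_root_edges`), then `club_of_markers`. -/
theorem Club_of_skeleton {p : E → R} (hp : IsProbVec p) (ends : E → Sym2 V) (o b s t w : V)
    (H : ∀ e, w ∈ ends e → p e ≠ 0 →
      ends e = s(w, s) ∨ ends e = s(w, t) ∨ ends e = s(w, b) ∨ ends e = s(w, o))
    (Hb : ∀ e e', ends e = s(w, b) → ends e' = s(w, b) → p e ≠ 0 → p e' ≠ 0 → e = e')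
    (Ho : ∀ e e', ends e = s(w, o) → ends e' = s(w, o) → p e ≠ 0 → p e' ≠ 0 → e = e')
    (hws : s ≠ w) (hwt : t ≠ w) (hwb : b ≠ w) (hwo : o ≠ w) : Club p ends o b s t w := by
  refine RBClubRoot.Club_of_no_root_edges ends hp o b s t w ?_
  set p' : E → R := fun e => if ends e = s(w, s) ∨ ends e = s(w, t) then 0 else p e with hp'
  have hp'v : IsProbVec p' :=
    ⟨fun e => by simp only [hp']; split_ifs; exacts [le_rfl, hp.nonneg e],
     fun e => by simp only [hp']; split_ifs; exacts [zero_le_one, hp.le_one e]⟩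
  have hne : ∀ e, p' e ≠ 0 → ¬(ends e = s(w, s) ∨ ends e = s(w, t)) ∧ p e ≠ 0 := by
    intro e h
    by_cases hF : ends e = s(w, s) ∨ ends e = s(w, t)
    · exact absurd (by simp [hp', hF]) h
    · exact ⟨hF, by simpa [hp', hF] using h⟩
  refine RBClubKernel.club_of_markers ends s t w hp'v o b ?_ ?_ ?_ hws hwt hwb hwo
  · intro e he hpe
    obtain ⟨hF, hpe'⟩ := hne e hpe
    rcases H e he hpe' with h | h | h | h
    · exact absurd (Or.inl h) hF
    · exact absurd (Or.inr h) hF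
    · exact Or.inl h
    · exact Or.inr h
  · intro e e' he he' hpe hpe'
    exact Hb e e' he he' (hne e hpe).2 (hne e' hpe').2
  · intro e e' he he' hpe hpe'
    exact Ho e e' he he' (hne e hpe).2 (hne e' hpe').2

omit [Fintype V] [DecidableEq V] [IsStrictOrderedRing R] in
/-- The seven masses of the coarse row do not see the multiplicity of a parallel pair of edges. -/
lemma club_merge_parallel (p : E → R) (ends : E → Sym2 V) (o b s t w : V) {e e' : E} (hne : e ≠ e')
    (hpar : ends e = ends e') :
    Club p ends o b s t w ↔
      Club (Function.update (Function.update p e (p e + p e' - p e * p e')) e' 0) ends o b s t w := by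
  have hQ : ∀ ω : Config E, ω ∈ Qst ends s t ↔
      Function.update (Function.update ω e (ω e || ω e')) e' false ∈ Qst ends s t := by
    intro ω
    simp only [Qst, Set.mem_compl_iff, mem_connEvent]
    exact not_congr (RBParallel.conn_merge ends hne hpar ω s t).symm
  have hC : ∀ (x y : V) (ω : Config E), ω ∈ connEvent ends x y ↔
      Function.update (Function.update ω e (ω e || ω e')) e' false ∈ connEvent ends x y := by
    intro x y ω
    simp only [mem_connEvent]
    exact (RBParallel.conn_merge ends hne hpar ω x y).symm
  have m1 := RBParallel.prob_merge_parallel p hne (Qst ends s t ∩ connEvent ends b s) fun ω => by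
    simp only [Set.mem_inter_iff]; exact and_congr (hQ ω) (hC b s ω)
  have m2 := RBParallel.prob_merge_parallel p hne (Qst ends s t ∩ connEvent ends o s) fun ω => by
    simp only [Set.mem_inter_iff]; exact and_congr (hQ ω) (hC o s ω)
  have m3 := RBParallel.prob_merge_parallel p hne (Qst ends s t) hQ
  have m4 := RBParallel.prob_merge_parallel p hne
    (Qst ends s t ∩ connEvent ends s w ∩ connEvent ends b s ∩ connEvent ends o s) fun ω => by
    simp only [Set.mem_inter_iff]
    exact and_congr (and_congr (and_congr (hQ ω) (hC s w ω)) (hC b s ω)) (hC o s ω)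
  have m5 := RBParallel.prob_merge_parallel p hne
    (Qst ends s t ∩ (connEvent ends s w)ᶜ ∩ connEvent ends b s) fun ω => by
    simp only [Set.mem_inter_iff, Set.mem_compl_iff]
    exact and_congr (and_congr (hQ ω) (not_congr (hC s w ω))) (hC b s ω)
  have m6 := RBParallel.prob_merge_parallel p hne
    (Qst ends s t ∩ (connEvent ends s w)ᶜ ∩ connEvent ends o s) fun ω => by
    simp only [Set.mem_inter_iff, Set.mem_compl_iff]
    exact and_congr (and_congr (hQ ω) (not_congr (hC s w ω))) (hC o s ω)
  have m7 := RBParallel.prob_merge_parallel p hne (Qst ends s t ∩ (connEvent ends s w)ᶜ) fun ω => by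
    simp only [Set.mem_inter_iff, Set.mem_compl_iff]
    exact and_congr (hQ ω) (not_congr (hC s w ω))
  unfold Club
  rw [m1, m2, m3, m4, m5, m6, m7]

/-- **THEOREM 2′RB-CLUB-K**: at every vertex `w ∉ {s, t, b, o}` whose edges of nonzero weight all
end in `{s, t, b, o}` (any multiplicity), the coarse row `Club` holds — parallel marker edges are
merged one pair at a time (`club_merge_parallel`), then `Club_of_skeleton`. -/
theorem Club_of_nbhd' {p : E → R} (hp : IsProbVec p) (ends : E → Sym2 V) (o b s t w : V)
    (H : ∀ e, w ∈ ends e → p e ≠ 0 →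
      ends e = s(w, s) ∨ ends e = s(w, t) ∨ ends e = s(w, b) ∨ ends e = s(w, o))
    (hws : s ≠ w) (hwt : t ≠ w) (hwb : b ≠ w) (hwo : o ≠ w) : Club p ends o b s t w := by
  suffices key : ∀ n : ℕ, ∀ p : E → R, IsProbVec p →
      (∀ e, w ∈ ends e → p e ≠ 0 →
        ends e = s(w, s) ∨ ends e = s(w, t) ∨ ends e = s(w, b) ∨ ends e = s(w, o)) →
      (Finset.univ.filter (fun e => (ends e = s(w, b) ∨ ends e = s(w, o)) ∧ p e ≠ 0)).card ≤ n →
      Club p ends o b s t w from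
    key _ p hp H le_rfl
  intro n
  induction n with
  | zero =>
    intro p hp H hcard
    have hno : ∀ e, (ends e = s(w, b) ∨ ends e = s(w, o)) → p e ≠ 0 → False := by
      intro e he hpe
      have hmem : e ∈ Finset.univ.filter (fun e => (ends e = s(w, b) ∨ ends e = s(w, o)) ∧ p e ≠ 0) :=
        Finset.mem_filter.2 ⟨Finset.mem_univ e, he, hpe⟩
      have := Finset.card_pos.2 ⟨e, hmem⟩
      omega
    exact Club_of_skeleton hp ends o b s t w H
      (fun e _ he _ hpe _ => absurd hpe (hno e (Or.inl he)))
      (fun e _ he _ hpe _ => absurd hpe (hno e (Or.inr he))) hws hwt hwb hwo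
  | succ n ih =>
    intro p hp H hcard
    by_cases hsimple : (∀ e e', ends e = s(w, b) → ends e' = s(w, b) → p e ≠ 0 → p e' ≠ 0 → e = e') ∧
        (∀ e e', ends e = s(w, o) → ends e' = s(w, o) → p e ≠ 0 → p e' ≠ 0 → e = e')
    · exact Club_of_skeleton hp ends o b s t w H hsimple.1 hsimple.2 hws hwt hwb hwo
    -- a parallel pair of marker edges of nonzero weight: merge it
    have hpair : ∃ e e', e ≠ e' ∧ ends e = ends e' ∧ (ends e = s(w, b) ∨ ends e = s(w, o)) ∧
        p e ≠ 0 ∧ p e' ≠ 0 := by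
      rcases not_and_or.1 hsimple with hb | ho
      · simp only [not_forall] at hb
        obtain ⟨e, e', he, he', hpe, hpe', hne⟩ := hb
        exact ⟨e, e', hne, he.trans he'.symm, Or.inl he, hpe, hpe'⟩
      · simp only [not_forall] at ho
        obtain ⟨e, e', he, he', hpe, hpe', hne⟩ := ho
        exact ⟨e, e', hne, he.trans he'.symm, Or.inr he, hpe, hpe'⟩
    obtain ⟨e, e', hne, hpar, hmk, hpe, hpe'⟩ := hpair
    set p' : E → R := Function.update (Function.update p e (p e + p e' - p e * p e')) e' 0 with hp'
    have hp'v : IsProbVec p' := RBParallel.isProbVec_merge hp e e'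
    have H' : ∀ f, w ∈ ends f → p' f ≠ 0 →
        ends f = s(w, s) ∨ ends f = s(w, t) ∨ ends f = s(w, b) ∨ ends f = s(w, o) := by
      intro f hf hpf
      by_cases hfe' : f = e'
      · subst hfe'
        exact absurd (Function.update_self _ _ _) hpf
      · by_cases hfe : f = e
        · subst hfe
          rcases hmk with h | h
          · exact Or.inr (Or.inr (Or.inl h))
          · exact Or.inr (Or.inr (Or.inr h))
        · rw [hp', Function.update_of_ne hfe', Function.update_of_ne hfe] at hpf
          exact H f hf hpf
    have hcard' :
        (Finset.univ.filter (fun f => (ends f = s(w, b) ∨ ends f = s(w, o)) ∧ p' f ≠ 0)).card ≤ n := by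
      set F := Finset.univ.filter (fun f => (ends f = s(w, b) ∨ ends f = s(w, o)) ∧ p f ≠ 0) with hF
      have hsub : Finset.univ.filter (fun f => (ends f = s(w, b) ∨ ends f = s(w, o)) ∧ p' f ≠ 0) ⊆
          F.erase e' := by
        intro f hf
        rw [Finset.mem_filter] at hf
        rw [Finset.mem_erase, hF, Finset.mem_filter]
        have hfe' : f ≠ e' := by
          rintro rfl
          exact hf.2.2 (Function.update_self _ _ _)
        refine ⟨hfe', Finset.mem_univ f, hf.2.1, ?_⟩
        by_cases hfe : f = e
        · subst hfe; exact hpe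
        · have := hf.2.2
          rwa [hp', Function.update_of_ne hfe', Function.update_of_ne hfe] at this
      have hmem : e' ∈ F := Finset.mem_filter.2 ⟨Finset.mem_univ e', by rw [← hpar]; exact hmk, hpe'⟩
      have h1 := Finset.card_le_card hsub
      rw [Finset.card_erase_of_mem hmem] at h1
      omega
    have key := ih p' hp'v H' hcard'
    exact (club_merge_parallel p ends o b s t w hne hpar).2 key

end RB

end Summit.Ventures.PercRepro2
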